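import Literature.NumberTheory.LFunctions.IncompleteKloostermanSmooth
import HarnessLib

/-!
# Additive phases of fractions `e_d(c/m)` (Polymath 8a §4.1, Lemma 4.4, Lemma 4.8)

Topic `Literature/NumberTheory/Sieve`, grouping namespace `Polymath8a`; a support file for the named
fact `Literature.NumberTheory.Sieve.mpz_of_lt` (**parity.S29**, `ParityWave0.lean`).  Source:
D. H. J. Polymath, *New equidistribution estimates of Zhang type*, Algebra & Number Theory 8:9 (2014)
2067–2199 = arXiv:1402.0811, §4.1 (the extension of `e_q` to fractions: "`e_q((a,b)) = e_q(a b⁻¹)` if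
`b ∈ (ℤ/qℤ)^×`, and `e_q((a,b)) = 0` otherwise"), §4.3 **Lemma 4.4** (Chinese Remainder Theorem:
"`e_{q₁q₂}(a) = e_{q₁}(a/q₂) e_{q₂}(a/q₁)`") and **Lemma 4.8** ("Let `d₁, d₂` be squarefree integers …
`|∑_{n ∈ ℤ/[d₁,d₂]ℤ} e_{d₁}(c₁/(n+l₁)) e_{d₂}(c₂/(n+l₂))| ≤ C^{Ω([d₁,d₂])} (c₁,δ₁)(c₂,δ₂)(d₁,d₂)`,
`δ_i = d_i/(d₁,d₂)` … by the change of variable `m = c₁/(n+l)` this sum is just a Ramanujan sum").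

The phases `e_d(c/(n+l))` are the building blocks of all the exponential sums of the Type I/II
estimates (§5: the phase `Φ_ℓ` of (5.23), Proposition 5.10, §§5.5–5.6) and of Corollary 4.16.  We fix
the convention used throughout the paper for these one-pole phases — the value is `0` unless `n + l`
is invertible modulo `d` — which is also the convention already used (inline) by the tree's
`Literature.NumberTheory.LFunctions.MatomakiMerikoski.norm_completeSum_eq`:

* `Polymath8a.eFrac d c m` — `e_d(c/m) := e(c m̄/d)` if `(m, d) = 1` (`m̄ m ≡ 1 (mod d)`), else `0`;
  with its algebra: `eFrac_of_isUnit/of_not_isUnit`, `norm_eFrac_le_one`, periodicity in `m` and in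
  `c` (`eFrac_add_mul_self`, `eFrac_congr_left`), units in the denominator
  (`eFrac_unit_mul`: `e_d(c/(um)) = e_d((c ū)/m)`), `eFrac_one_left` (`d = 1`);
* `Polymath8a.eFrac_mul_of_coprime` — **Lemma 4.4**: for coprime `d₁, d₂`,
  `e_{d₁d₂}(c/m) = e_{d₁}(c/(d₂m)) · e_{d₂}(c/(d₁m))`;
* `Polymath8a.sum_range_mul_of_coprime_periodic` — the Chinese-remainder factorisation of complete
  sums: `∑_{n mod ab} F(n) G(n) = (∑_{n mod a} F)(∑_{n mod b} G)` for coprime `a, b`, `F` `a`-periodic,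
  `G` `b`-periodic (the step "we can factor the sum as a product of exponential sums over the prime
  divisors" in the proofs of Proposition 4.6 and Lemma 4.8);
* `Polymath8a.sum_range_eFrac_add` — the complete sum of a one-pole phase is a Ramanujan sum,
  `∑_{n mod d} e_d(c/(n + l)) = c_d(c)`, whence `|…| ≤ (c, d)` (`norm_sum_range_eFrac_add_le`);
* `Polymath8a.norm_sum_eFrac_mul_eFrac_le` — **Lemma 4.8**, PROVED with the constant `C = 1`:
  for squarefree `d₁, d₂` and integers `c₁, c₂, l₁, l₂`,
  `|∑_{n mod [d₁,d₂]} e_{d₁}(c₁/(n+l₁)) e_{d₂}(c₂/(n+l₂))| ≤ (c₁, δ₁)(c₂, δ₂)(d₁, d₂)`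
  (induction over the primes `p ∣ [d₁, d₂]`: Lemma 4.4 splits off the `p`-part, which is a Ramanujan
  sum `≤ (c_i, p)` when `p` divides one `d_i` only and is bounded trivially by `p` when `p ∣ (d₁, d₂)`).

Everything is PROVED; the only new definition is `eFrac` (no named facts).

## References

* D. H. J. Polymath, *New equidistribution estimates of Zhang type*, Algebra & Number Theory 8:9
  (2014) 2067–2199, arXiv:1402.0811: §4.1, Example 4.1, Lemma 4.4, Lemma 4.8 and their proofs.
  [cite: Polymath8a2014, §4.1, Lemma 4.4, Lemma 4.8]
-/

noncomputable section

open Finset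
open scoped ComplexConjugate

namespace Literature.NumberTheory.Sieve

namespace Polymath8a

open Literature.NumberTheory.LFunctions (kloostermanSum sum_zmod_eq_sum_range)
open Literature.NumberTheory.LFunctions.MatomakiMerikoski (kloostermanSum_zero_left_eq_ramanujanSum
  norm_ramanujanSum_le_gcd)

/-! ### The phase `e_d(c/m)` -/

/-- **Polymath's additive phase of a fraction**, `e_d(c/m)`: "`e_q((a,b)) = e_q(ab⁻¹)` if
`b ∈ (ℤ/qℤ)^×`, and `e_q((a,b)) = 0` otherwise" (§4.1), for the fractions `c/m` with integer `c, m`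
that occur in the paper (the phases `e_d(c/(n + l))` of Lemma 4.8, Corollary 4.16 and §5): the value is
`e(c m̄/d)` when `(m, d) = 1` (`m̄` the inverse of `m` modulo `d`) and `0` otherwise.  (For a modulus
`d` and a prime `p ∣ d` dividing both `c` and `m` the paper's projective convention would first cancel
`p`; the two conventions agree whenever `(m, d) = 1` or `(c, m, d) = 1`, which covers every use, and
the present one is the one of the tree's `MatomakiMerikoski.norm_completeSum_eq`.)
[cite: Polymath8a2014, §4.1] -/
def eFrac (d : ℕ) [NeZero d] (c m : ℤ) : ℂ :=
  by classical exact if IsUnit (m : ZMod d) then (ZMod.stdAddChar ((c : ZMod d) * (m : ZMod d)⁻¹) : ℂ) else 0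

variable {d : ℕ} [NeZero d]

/-- The value at an invertible denominator: `e_d(c/m) = e(c m̄/d)`. [folklore] -/
theorem eFrac_of_isUnit {c m : ℤ} (h : IsUnit (m : ZMod d)) :
    eFrac d c m = ZMod.stdAddChar ((c : ZMod d) * (m : ZMod d)⁻¹) := by
  classical
  unfold eFrac; rw [if_pos h]

/-- The value at a pole: `e_d(c/m) = 0` if `m` is not invertible modulo `d`. [folklore] -/
theorem eFrac_of_not_isUnit {c m : ℤ} (h : ¬ IsUnit (m : ZMod d)) : eFrac d c m = 0 := by
  classical
  unfold eFrac; rw [if_neg h]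

/-- `e_d(c/m) = 0` unless `(m, d) = 1`, in the `IsCoprime` form. [cite: Polymath8a2014, §4.1] -/
theorem eFrac_eq_zero_of_not_isCoprime {c m : ℤ} (h : ¬ IsCoprime (d : ℤ) m) : eFrac d c m = 0 :=
  eFrac_of_not_isUnit (mt (ZMod.coe_int_isUnit_iff_isCoprime m d).mp h)

/-- The values of the standard additive character have modulus one. [folklore] -/
theorem norm_stdAddChar (x : ZMod d) : ‖(ZMod.stdAddChar x : ℂ)‖ = 1 := by
  rw [ZMod.stdAddChar_apply, Circle.norm_coe]

/-- `|e_d(c/m)| ≤ 1`. [folklore] -/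
theorem norm_eFrac_le_one (c m : ℤ) : ‖eFrac d c m‖ ≤ 1 := by
  by_cases h : IsUnit (m : ZMod d)
  · rw [eFrac_of_isUnit h, norm_stdAddChar]
  · rw [eFrac_of_not_isUnit h, norm_zero]; exact zero_le_one

/-- `|e_d(c/m)| = 1` when `(m, d) = 1`. [folklore] -/
theorem norm_eFrac_of_isUnit {c m : ℤ} (h : IsUnit (m : ZMod d)) : ‖eFrac d c m‖ = 1 := by
  rw [eFrac_of_isUnit h, norm_stdAddChar]

/-- `e_d(c/m)` only depends on `m` modulo `d`. [folklore] -/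
theorem eFrac_congr_right (c : ℤ) {m m' : ℤ} (h : (m : ZMod d) = m') : eFrac d c m = eFrac d c m' := by
  classical
  unfold eFrac; rw [h]

/-- `e_d(c/m)` only depends on `c` modulo `d`. [folklore] -/
theorem eFrac_congr_left {c c' : ℤ} (h : (c : ZMod d) = c') (m : ℤ) : eFrac d c m = eFrac d c' m := by
  classical
  unfold eFrac; rw [h]

/-- Periodicity: `e_d(c/(m + dn)) = e_d(c/m)`. [folklore] -/
theorem eFrac_add_mul_self (c m n : ℤ) : eFrac d c (m + d * n) = eFrac d c m :=
  eFrac_congr_right c (by push_cast; simp)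

/-- **Units in the denominator**: if `u v ≡ 1 (mod d)` then `e_d(c/(um)) = e_d((cv)/m)`.
[cite: Polymath8a2014, §4.1] -/
theorem eFrac_unit_mul {u v : ℤ} (huv : (u : ZMod d) * (v : ZMod d) = 1) (c m : ℤ) :
    eFrac d c (u * m) = eFrac d (c * v) m := by
  have hu : IsUnit (u : ZMod d) := IsUnit.of_mul_eq_one _ huv
  by_cases hm : IsUnit (m : ZMod d)
  · have hum : IsUnit ((u * m : ℤ) : ZMod d) := by push_cast; exact hu.mul hm
    rw [eFrac_of_isUnit hum, eFrac_of_isUnit hm]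
    congr 1
    have hinv : ((u * m : ℤ) : ZMod d)⁻¹ = (v : ZMod d) * (m : ZMod d)⁻¹ := by
      apply ZMod.inv_eq_of_mul_eq_one
      push_cast
      calc (u : ZMod d) * (m : ZMod d) * ((v : ZMod d) * (m : ZMod d)⁻¹)
          = ((u : ZMod d) * (v : ZMod d)) * ((m : ZMod d) * (m : ZMod d)⁻¹) := by ring
        _ = 1 := by rw [huv, ZMod.mul_inv_of_unit _ hm, one_mul]
    rw [hinv]
    push_cast
    ring
  · have hum : ¬ IsUnit ((u * m : ℤ) : ZMod d) := by
      push_cast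
      intro h
      exact hm (isUnit_of_mul_isUnit_right h)
    rw [eFrac_of_not_isUnit hum, eFrac_of_not_isUnit hm]

/-- Modulus `1`: `e_1(c/m) = 1`. [folklore] -/
theorem eFrac_one_left (c m : ℤ) : eFrac 1 c m = 1 := by
  rw [eFrac_of_isUnit (isUnit_of_subsingleton _), Subsingleton.elim ((c : ZMod 1) * (m : ZMod 1)⁻¹) 0,
    AddChar.map_zero_eq_one]

/-! ### Lemma 4.4: the Chinese Remainder Theorem for `e_d(c/m)` -/

/-- An integer representative of the inverse: `(m̄ : ZMod d) = ((m⁻¹).val : ℤ)`. [folklore] -/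
theorem inv_eq_intCast_val (m : ℤ) :
    (m : ZMod d)⁻¹ = ((((m : ZMod d)⁻¹).val : ℤ) : ZMod d) := by
  rw [Int.cast_natCast, ZMod.natCast_zmod_val]

/-- **Polymath 8a, Lemma 4.4** (Chinese Remainder Theorem): for coprime `d₁, d₂` and the fraction
`a = c/m`, "`e_{q₁q₂}(a) = e_{q₁}(a/q₂) e_{q₂}(a/q₁)`", i.e.
`e_{d₁d₂}(c/m) = e_{d₁}(c/(d₂m)) · e_{d₂}(c/(d₁m))` (both sides vanish unless `(m, d₁d₂) = 1`; for a unit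
`m` the printed proof applies verbatim: with `q₁q̄₁ ≡ 1 (q₂)`, `q₂q̄₂ ≡ 1 (q₁)` one has
`q₁q̄₁ + q₂q̄₂ ≡ 1 (q₁q₂)`). [cite: Polymath8a2014, Lemma 4.4] -/
theorem eFrac_mul_of_coprime {d₁ d₂ : ℕ} [NeZero d₁] [NeZero d₂] (hcop : d₁.Coprime d₂) (c m : ℤ) :
    eFrac (d₁ * d₂) c m = eFrac d₁ c (d₂ * m) * eFrac d₂ c (d₁ * m) := by
  have hcopZ : IsCoprime (d₁ : ℤ) (d₂ : ℤ) := Nat.isCoprime_iff_coprime.mpr hcop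
  by_cases hm : IsUnit (m : ZMod (d₁ * d₂))
  · -- `m` is coprime to `d₁ d₂`
    have hmc : IsCoprime ((d₁ * d₂ : ℕ) : ℤ) m := (ZMod.coe_int_isUnit_iff_isCoprime m (d₁ * d₂)).mp hm
    push_cast at hmc
    have hm1 : IsCoprime (d₁ : ℤ) m := hmc.of_mul_left_left
    have hm2 : IsCoprime (d₂ : ℤ) m := hmc.of_mul_left_right
    have h1 : IsUnit ((d₂ * m : ℤ) : ZMod d₁) :=
      (ZMod.coe_int_isUnit_iff_isCoprime _ d₁).mpr (hcopZ.mul_right hm1)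
    have h2 : IsUnit ((d₁ * m : ℤ) : ZMod d₂) :=
      (ZMod.coe_int_isUnit_iff_isCoprime _ d₂).mpr (hcopZ.symm.mul_right hm2)
    rw [eFrac_of_isUnit hm, eFrac_of_isUnit h1, eFrac_of_isUnit h2]
    -- integer representatives of the two inverses
    set v₁ : ℤ := ((((d₂ * m : ℤ) : ZMod d₁)⁻¹).val : ℤ) with hv₁
    set v₂ : ℤ := ((((d₁ * m : ℤ) : ZMod d₂)⁻¹).val : ℤ) with hv₂
    have hV₁ : ((d₂ * m : ℤ) : ZMod d₁)⁻¹ = (v₁ : ZMod d₁) := inv_eq_intCast_val _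
    have hV₂ : ((d₁ * m : ℤ) : ZMod d₂)⁻¹ = (v₂ : ZMod d₂) := inv_eq_intCast_val _
    have hinv₁ : ((d₂ * m * v₁ : ℤ) : ZMod d₁) = ((1 : ℤ) : ZMod d₁) := by
      have := ZMod.mul_inv_of_unit _ h1
      rw [hV₁] at this
      push_cast at this ⊢
      exact this
    have hinv₂ : ((d₁ * m * v₂ : ℤ) : ZMod d₂) = ((1 : ℤ) : ZMod d₂) := by
      have := ZMod.mul_inv_of_unit _ h2
      rw [hV₂] at this
      push_cast at this ⊢
      exact this
    rw [ZMod.intCast_eq_intCast_iff] at hinv₁ hinv₂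
    -- the CRT representative `v₁ d₂ + v₂ d₁` of `m⁻¹ (mod d₁d₂)`
    have hmod₁ : m * (v₁ * d₂ + v₂ * d₁) ≡ 1 [ZMOD (d₁ : ℤ)] := by
      have hz : m * (v₁ * d₂ + v₂ * d₁) = d₂ * m * v₁ + d₁ * (m * v₂) := by ring
      rw [hz]
      calc d₂ * m * v₁ + d₁ * (m * v₂) ≡ d₂ * m * v₁ + 0 [ZMOD (d₁ : ℤ)] :=
            Int.ModEq.add_left _ (Int.modEq_zero_iff_dvd.mpr (dvd_mul_right _ _))
        _ ≡ 1 [ZMOD (d₁ : ℤ)] := by simpa using hinv₁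
    have hmod₂ : m * (v₁ * d₂ + v₂ * d₁) ≡ 1 [ZMOD (d₂ : ℤ)] := by
      have hz : m * (v₁ * d₂ + v₂ * d₁) = d₁ * m * v₂ + d₂ * (m * v₁) := by ring
      rw [hz]
      calc d₁ * m * v₂ + d₂ * (m * v₁) ≡ d₁ * m * v₂ + 0 [ZMOD (d₂ : ℤ)] :=
            Int.ModEq.add_left _ (Int.modEq_zero_iff_dvd.mpr (dvd_mul_right _ _))
        _ ≡ 1 [ZMOD (d₂ : ℤ)] := by simpa using hinv₂
    have hmod : m * (v₁ * d₂ + v₂ * d₁) ≡ 1 [ZMOD ((d₁ * d₂ : ℕ) : ℤ)] := by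
      have hcop' : ((d₁ : ℤ)).natAbs.Coprime ((d₂ : ℤ)).natAbs := by simpa using hcop
      have h := (Int.modEq_and_modEq_iff_modEq_mul (a := m * (v₁ * d₂ + v₂ * d₁)) (b := 1)
        hcop').mp ⟨hmod₁, hmod₂⟩
      push_cast
      exact h
    have hkey : (m : ZMod (d₁ * d₂))⁻¹ = ((v₁ * d₂ + v₂ * d₁ : ℤ) : ZMod (d₁ * d₂)) := by
      apply ZMod.inv_eq_of_mul_eq_one
      have e := (ZMod.intCast_eq_intCast_iff _ _ (d₁ * d₂)).mpr hmod
      push_cast at e ⊢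
      exact e
    rw [hkey, hV₁, hV₂,
      show ((c : ZMod (d₁ * d₂)) * ((v₁ * d₂ + v₂ * d₁ : ℤ) : ZMod (d₁ * d₂))) =
        ((c * (v₁ * d₂ + v₂ * d₁) : ℤ) : ZMod (d₁ * d₂)) by push_cast; ring,
      show ((c : ZMod d₁) * (v₁ : ZMod d₁)) = ((c * v₁ : ℤ) : ZMod d₁) by push_cast; ring,
      show ((c : ZMod d₂) * (v₂ : ZMod d₂)) = ((c * v₂ : ℤ) : ZMod d₂) by push_cast; ring,
      ZMod.stdAddChar_coe, ZMod.stdAddChar_coe, ZMod.stdAddChar_coe, ← Complex.exp_add]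
    congr 1
    have h₁ : (d₁ : ℂ) ≠ 0 := by exact_mod_cast NeZero.ne d₁
    have h₂ : (d₂ : ℂ) ≠ 0 := by exact_mod_cast NeZero.ne d₂
    push_cast
    field_simp
  · -- `m` is not a unit modulo `d₁d₂`: one of the two factors vanishes
    rw [eFrac_of_not_isUnit hm]
    symm
    by_contra hne
    obtain ⟨hne1, hne2⟩ := mul_ne_zero_iff.mp hne
    have h1 : IsUnit ((d₂ * m : ℤ) : ZMod d₁) := by
      by_contra h; exact hne1 (eFrac_of_not_isUnit h)
    have h2 : IsUnit ((d₁ * m : ℤ) : ZMod d₂) := by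
      by_contra h; exact hne2 (eFrac_of_not_isUnit h)
    rw [ZMod.coe_int_isUnit_iff_isCoprime] at h1 h2
    apply hm
    rw [ZMod.coe_int_isUnit_iff_isCoprime]
    push_cast
    exact IsCoprime.mul_left h1.of_mul_right_right h2.of_mul_right_right

/-! ### Chinese-remainder factorisation of complete sums -/

/-- A `d`-periodic function on `ℤ` is determined by the residue: `F(n) = F(n mod d)`. [folklore] -/
theorem periodic_eq_emod {q : ℕ} {F : ℤ → ℂ} (hF : ∀ m n : ℤ, F (m + q * n) = F m) (n : ℤ) :
    F n = F (n % q) := by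
  conv_lhs => rw [← Int.emod_add_mul_ediv n q]
  exact hF _ _

/-- **Factorisation of complete sums over coprime moduli** (the Chinese Remainder Theorem, as used in
the proofs of Proposition 4.6 and Lemma 4.8: "we can factor the sum as a product of exponential sums
over the prime divisors of `q`"): for coprime `a, b ≥ 1`, `F` `a`-periodic and `G` `b`-periodic,
`∑_{0 ≤ n < ab} F(n) G(n) = (∑_{0 ≤ n < a} F(n)) (∑_{0 ≤ n < b} G(n))`.
[cite: Polymath8a2014, proof of Proposition 4.6] -/
theorem sum_range_mul_of_coprime_periodic {a b : ℕ} (hab : a.Coprime b) (ha : a ≠ 0) (hb : b ≠ 0)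
    {F G : ℤ → ℂ} (hF : ∀ m n : ℤ, F (m + a * n) = F m) (hG : ∀ m n : ℤ, G (m + b * n) = G m) :
    ∑ n ∈ Finset.range (a * b), F n * G n =
      (∑ i ∈ Finset.range a, F i) * ∑ j ∈ Finset.range b, G j := by
  rw [Finset.sum_mul_sum, ← Finset.sum_product']
  refine Finset.sum_bij' (fun n _ => ((n % a, n % b) : ℕ × ℕ))
    (fun x _ => ((Nat.chineseRemainder hab x.1 x.2 : ℕ))) ?_ ?_ ?_ ?_ ?_
  · intro n _
    simp only [Finset.mem_product, Finset.mem_range]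
    exact ⟨Nat.mod_lt _ (Nat.pos_of_ne_zero ha), Nat.mod_lt _ (Nat.pos_of_ne_zero hb)⟩
  · intro x _
    rw [Finset.mem_range]
    exact Nat.chineseRemainder_lt_mul hab _ _ ha hb
  · intro n hn
    rw [Finset.mem_range] at hn
    have h := Nat.chineseRemainder_modEq_unique hab (a := n % a) (b := n % b) (z := n)
      (Nat.mod_modEq _ _).symm (Nat.mod_modEq _ _).symm
    exact (Nat.ModEq.eq_of_lt_of_lt h hn (Nat.chineseRemainder_lt_mul hab _ _ ha hb)).symm
  · intro x hx
    simp only [Finset.mem_product, Finset.mem_range] at hx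
    obtain ⟨h1, h2⟩ := (Nat.chineseRemainder hab x.1 x.2).prop
    refine Prod.ext ?_ ?_
    · exact Eq.trans h1 (Nat.mod_eq_of_lt hx.1)
    · exact Eq.trans h2 (Nat.mod_eq_of_lt hx.2)
  · intro n _
    simp only
    congr 1
    · rw [periodic_eq_emod (q := a) hF]
      push_cast
      rfl
    · rw [periodic_eq_emod (q := b) hG]
      push_cast
      rfl

/-! ### Complete sums of a one-pole phase: Ramanujan sums -/

/-- Shifting a complete sum of a `d`-periodic function: `∑_{0 ≤ n < d} F(n + l) = ∑_{0 ≤ n < d} F(n)`.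
[folklore] -/
theorem sum_range_comp_add_of_periodic {F : ℤ → ℂ} (hF : ∀ m n : ℤ, F (m + d * n) = F m) (l : ℤ) :
    ∑ n ∈ Finset.range d, F (n + l) = ∑ n ∈ Finset.range d, F n := by
  have hF' : ∀ k : ℤ, F k = F (((k : ZMod d)).val : ℕ) := fun k => by
    rw [periodic_eq_emod (q := d) hF k]
    congr 1
    exact (ZMod.val_intCast k).symm
  calc ∑ n ∈ Finset.range d, F (n + l)
      = ∑ n ∈ Finset.range d, F ((((n : ℕ) : ZMod d) + (l : ZMod d)).val : ℕ) := by
        refine Finset.sum_congr rfl fun n _ => ?_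
        rw [hF' (n + l)]; push_cast; rfl
    _ = ∑ x : ZMod d, F ((x + (l : ZMod d)).val : ℕ) :=
        (sum_zmod_eq_sum_range (fun x : ZMod d => F ((x + (l : ZMod d)).val : ℕ))).symm
    _ = ∑ x : ZMod d, F (x.val : ℕ) :=
        Fintype.sum_equiv (Equiv.addRight (l : ZMod d)) _ _ fun x => rfl
    _ = ∑ n ∈ Finset.range d, F (((n : ℕ) : ZMod d).val : ℕ) := sum_zmod_eq_sum_range _
    _ = ∑ n ∈ Finset.range d, F n := by
        refine Finset.sum_congr rfl fun n _ => ?_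
        rw [hF' (n : ℤ)]; push_cast; rfl

/-- The phase `m ↦ e_d(c/m)` is `d`-periodic. [folklore] -/
theorem eFrac_periodic (c : ℤ) (m n : ℤ) : eFrac d c (m + d * n) = eFrac d c m :=
  eFrac_add_mul_self c m n

/-- **The complete sum of a one-pole phase is a Ramanujan sum**:
`∑_{0 ≤ n < d} e_d(c/n) = c_d(c)` (the tree's `ramanujanSum`; "this sum is just a Ramanujan sum",
proof of Lemma 4.8). [cite: Polymath8a2014, proof of Lemma 4.8] -/
theorem sum_range_eFrac_eq_ramanujanSum (c : ℤ) :
    ∑ n ∈ Finset.range d, eFrac d c n = ramanujanSum d (((c : ZMod d).val : ℕ) : ℤ) := by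
  classical
  rw [← kloostermanSum_zero_left_eq_ramanujanSum d (c : ZMod d)]
  unfold Literature.NumberTheory.LFunctions.kloostermanSum
  rw [sum_zmod_eq_sum_range]
  refine Finset.sum_congr rfl fun n _ => ?_
  by_cases h : IsUnit ((n : ℕ) : ZMod d)
  · have h' : IsUnit (((n : ℕ) : ℤ) : ZMod d) := by rwa [Int.cast_natCast]
    rw [eFrac_of_isUnit h', if_pos h, Int.cast_natCast, zero_mul, zero_add]
  · have h' : ¬ IsUnit (((n : ℕ) : ℤ) : ZMod d) := by rwa [Int.cast_natCast]
    rw [eFrac_of_not_isUnit h', if_neg h]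

/-- The shifted complete sum: `∑_{0 ≤ n < d} e_d(c/(n + l)) = c_d(c)`. [cite: Polymath8a2014, proof of Lemma 4.8] -/
theorem sum_range_eFrac_add (c l : ℤ) :
    ∑ n ∈ Finset.range d, eFrac d c (n + l) = ramanujanSum d (((c : ZMod d).val : ℕ) : ℤ) := by
  rw [sum_range_comp_add_of_periodic (d := d) (eFrac_periodic c) l, sum_range_eFrac_eq_ramanujanSum]

/-- **The Ramanujan-sum bound** `|∑_{0 ≤ n < d} e_d(c/(n + l))| ≤ (c, d)`.
[cite: Polymath8a2014, Example 4.7 (4.11) and proof of Lemma 4.8] -/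
theorem norm_sum_range_eFrac_add_le (c l : ℤ) :
    ‖∑ n ∈ Finset.range d, eFrac d c (n + l)‖ ≤ Int.gcd c d := by
  rw [sum_range_eFrac_add]
  refine (norm_ramanujanSum_le_gcd d _).trans (le_of_eq ?_)
  congr 1
  rw [ZMod.val_intCast, Int.gcd_emod]

/-- `(cv, d) = (c, d)` for `v` coprime to `d`. [folklore] -/
theorem int_gcd_mul_right_of_isCoprime (c : ℤ) {v : ℤ} {n : ℕ} (hv : IsCoprime v n) :
    Int.gcd (c * v) n = Int.gcd c n := by
  rw [Int.gcd_eq_natAbs, Int.gcd_eq_natAbs, Int.natAbs_mul, Int.natAbs_natCast]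
  refine Nat.Coprime.gcd_mul_right_cancel _ ?_
  have h := Int.isCoprime_iff_gcd_eq_one.mp hv
  rwa [Int.gcd_eq_natAbs, Int.natAbs_natCast] at h

/-- **Units in the denominator do not change the Ramanujan bound**: for `u` coprime to `d`,
`|∑_{0 ≤ n < d} e_d(c/(u(n + l)))| ≤ (c, d)`. [cite: Polymath8a2014, proof of Lemma 4.8] -/
theorem norm_sum_range_eFrac_unit_mul_add_le (c l : ℤ) {u : ℤ} (hu : IsCoprime u d) :
    ‖∑ n ∈ Finset.range d, eFrac d c (u * (n + l))‖ ≤ Int.gcd c d := by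
  obtain ⟨v, w, hvw⟩ := hu
  have huv : (u : ZMod d) * (v : ZMod d) = 1 := by
    have h := congrArg (fun z : ℤ => (z : ZMod d)) hvw
    push_cast at h
    rw [ZMod.natCast_self, mul_zero, add_zero] at h
    rw [mul_comm]; exact h
  have hv : IsCoprime v d := ⟨u, w, by linarith [hvw]⟩
  simp_rw [eFrac_unit_mul huv]
  rw [← int_gcd_mul_right_of_isCoprime c hv]
  exact norm_sum_range_eFrac_add_le (c * v) l


/-! ### Lemma 4.8 -/

/-- Adding a multiple of the modulus inside the denominator: `e_d(c/(a(m + t + l))) = e_d(c/(a(m + l)))`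
for `d ∣ t`. [folklore] -/
theorem eFrac_arg_add_of_dvd {t : ℤ} (ht : (d : ℤ) ∣ t) (c a m l : ℤ) :
    eFrac d c (a * (m + t + l)) = eFrac d c (a * (m + l)) := by
  refine eFrac_congr_right _ ?_
  obtain ⟨s, rfl⟩ := ht
  push_cast
  rw [ZMod.natCast_self]
  ring

/-- **Splitting off a prime** (Lemma 4.4 for `d = pe`, `(p, e) = 1`):
`e_{pe}(c/(um)) = e_p(c/((eu)m)) · e_e(c/((pu)m))`. [cite: Polymath8a2014, Lemma 4.4] -/
theorem eFrac_prime_mul_split {p e : ℕ} [NeZero p] [NeZero e] (hpe : p.Coprime e) (c u m : ℤ) :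
    eFrac (p * e) c (u * m) = eFrac p c (e * u * m) * eFrac e c (p * u * m) := by
  rw [eFrac_mul_of_coprime hpe]
  congr 2 <;> ring

/-- For a prime `p` and a squarefree `d` with `p ∣ d`: `d = p e` with `p ∤ e`, `e` squarefree.
[folklore] -/
theorem exists_eq_prime_mul_of_squarefree {p d : ℕ} (hp : p.Prime) (hd : Squarefree d) (hpd : p ∣ d) :
    ∃ e : ℕ, d = p * e ∧ ¬ p ∣ e ∧ Squarefree e := by
  obtain ⟨e, rfl⟩ := hpd
  refine ⟨e, rfl, fun hpe => ?_, hd.of_mul_right⟩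
  obtain ⟨f, rfl⟩ := hpe
  have : p * p ∣ p * (p * f) := ⟨f, by ring⟩
  exact (Nat.squarefree_iff_prime_squarefree.mp hd) p hp this

/-- `lcm(pe, d) = p · lcm(e, d)` when `p` is coprime to `d`. [folklore] -/
theorem lcm_prime_mul_left {p e d : ℕ} (hpd : p.Coprime d) :
    Nat.lcm (p * e) d = p * Nat.lcm e d := by
  rcases Nat.eq_zero_or_pos p with rfl | hp
  · simp at hpd; subst hpd; simp
  unfold Nat.lcm
  rw [Nat.Coprime.gcd_mul_left_cancel e hpd, mul_assoc,
    Nat.mul_div_assoc p (Dvd.dvd.mul_right (Nat.gcd_dvd_left e d) d)]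

/-- `(c, mn) = (c, m)(c, n)` for coprime naturals `m, n` (as `Int.gcd` with an integer `c`).
[folklore] -/
theorem int_gcd_mul_of_coprime (c : ℤ) {m n : ℕ} (h : m.Coprime n) :
    Int.gcd c ((m * n : ℕ) : ℤ) = Int.gcd c m * Int.gcd c n := by
  rw [Int.gcd_eq_natAbs, Int.gcd_eq_natAbs, Int.gcd_eq_natAbs, Int.natAbs_natCast,
    Int.natAbs_natCast, Int.natAbs_natCast]
  exact Nat.Coprime.gcd_mul _ h

/-- **Polymath 8a, Lemma 4.8**, in the form carried through the induction over the primes of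
`[d₁, d₂]` (with arbitrary units `u_i` coprime to `d_i` in the denominators): for squarefree `d₁, d₂`,
`|∑_{n mod [d₁,d₂]} e_{d₁}(c₁/(u₁(n+l₁))) e_{d₂}(c₂/(u₂(n+l₂)))| ≤ (c₁, δ₁)(c₂, δ₂)(d₁, d₂)`,
`δ_i = d_i/(d₁, d₂)`. [cite: Polymath8a2014, Lemma 4.8] -/
theorem norm_sum_eFrac_mul_eFrac_le_aux (D : ℕ) :
    ∀ (d₁ d₂ : ℕ) [NeZero d₁] [NeZero d₂], Squarefree d₁ → Squarefree d₂ → Nat.lcm d₁ d₂ = D →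
      ∀ (c₁ c₂ l₁ l₂ u₁ u₂ : ℤ), IsCoprime u₁ d₁ → IsCoprime u₂ d₂ →
        ‖∑ n ∈ Finset.range D, eFrac d₁ c₁ (u₁ * (n + l₁)) * eFrac d₂ c₂ (u₂ * (n + l₂))‖ ≤
          Int.gcd c₁ (d₁ / Nat.gcd d₁ d₂ : ℕ) * Int.gcd c₂ (d₂ / Nat.gcd d₁ d₂ : ℕ) * Nat.gcd d₁ d₂ := by
  induction D using Nat.strong_induction_on with
  | _ D ih =>
  -- the step with the prime dividing `d₁` (the other case follows by symmetry)
  have key : ∀ (d₁ d₂ : ℕ) [NeZero d₁] [NeZero d₂], Squarefree d₁ → Squarefree d₂ → Nat.lcm d₁ d₂ = D →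
      ∀ p : ℕ, p.Prime → p ∣ d₁ → ∀ (c₁ c₂ l₁ l₂ u₁ u₂ : ℤ), IsCoprime u₁ d₁ → IsCoprime u₂ d₂ →
        ‖∑ n ∈ Finset.range D, eFrac d₁ c₁ (u₁ * (n + l₁)) * eFrac d₂ c₂ (u₂ * (n + l₂))‖ ≤
          Int.gcd c₁ (d₁ / Nat.gcd d₁ d₂ : ℕ) * Int.gcd c₂ (d₂ / Nat.gcd d₁ d₂ : ℕ) * Nat.gcd d₁ d₂ := by
    intro d₁ d₂ _ _ hd₁ hd₂ hD p hp hpd₁ c₁ c₂ l₁ l₂ u₁ u₂ hu₁ hu₂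
    haveI : NeZero p := ⟨hp.ne_zero⟩
    haveI : Fact p.Prime := ⟨hp⟩
    obtain ⟨e₁, rfl, hpe₁, he₁⟩ := exists_eq_prime_mul_of_squarefree hp hd₁ hpd₁
    haveI : NeZero e₁ := ⟨he₁.ne_zero⟩
    have hcop₁ : p.Coprime e₁ := (Nat.Prime.coprime_iff_not_dvd hp).mpr hpe₁
    -- `u₁` is coprime to `p` and to `e₁`
    have hu₁' : IsCoprime u₁ ((p : ℤ) * e₁) := by exact_mod_cast hu₁
    have hu₁p : IsCoprime u₁ (p : ℤ) := hu₁'.of_mul_right_left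
    have hu₁e : IsCoprime u₁ (e₁ : ℤ) := hu₁'.of_mul_right_right
    have hpZe : IsCoprime (p : ℤ) (e₁ : ℤ) := Nat.isCoprime_iff_coprime.mpr hcop₁
    -- split the first phase
    have hsplit₁ : ∀ n : ℕ, eFrac (p * e₁) c₁ (u₁ * (n + l₁)) =
        eFrac p c₁ (e₁ * u₁ * (n + l₁)) * eFrac e₁ c₁ (p * u₁ * (n + l₁)) :=
      fun n => eFrac_prime_mul_split hcop₁ c₁ u₁ _
    by_cases hpd₂ : p ∣ d₂
    · -- Case `p ∣ d₁`, `p ∣ d₂`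
      obtain ⟨e₂, rfl, hpe₂, he₂⟩ := exists_eq_prime_mul_of_squarefree hp hd₂ hpd₂
      haveI : NeZero e₂ := ⟨he₂.ne_zero⟩
      have hcop₂ : p.Coprime e₂ := (Nat.Prime.coprime_iff_not_dvd hp).mpr hpe₂
      have hu₂' : IsCoprime u₂ ((p : ℤ) * e₂) := by exact_mod_cast hu₂
      have hu₂p : IsCoprime u₂ (p : ℤ) := hu₂'.of_mul_right_left
      have hu₂e : IsCoprime u₂ (e₂ : ℤ) := hu₂'.of_mul_right_right
      have hsplit₂ : ∀ n : ℕ, eFrac (p * e₂) c₂ (u₂ * (n + l₂)) =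
          eFrac p c₂ (e₂ * u₂ * (n + l₂)) * eFrac e₂ c₂ (p * u₂ * (n + l₂)) :=
        fun n => eFrac_prime_mul_split hcop₂ c₂ u₂ _
      set E : ℕ := Nat.lcm e₁ e₂ with hE
      have hE0 : E ≠ 0 := Nat.lcm_ne_zero he₁.ne_zero he₂.ne_zero
      have hDE : D = p * E := by rw [← hD, Nat.lcm_mul_left]
      have hElt : E < D := by
        rw [hDE]; exact lt_mul_left (Nat.pos_of_ne_zero hE0) hp.one_lt
      have hpE : p.Coprime E :=
        Nat.Coprime.coprime_dvd_right (Nat.lcm_dvd_mul e₁ e₂) (Nat.Coprime.mul_right hcop₁ hcop₂)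
      have hg : Nat.gcd (p * e₁) (p * e₂) = p * Nat.gcd e₁ e₂ := Nat.gcd_mul_left p e₁ e₂
      -- the factorised sum
      have hsum : ∑ n ∈ Finset.range D, eFrac (p * e₁) c₁ (u₁ * (n + l₁)) * eFrac (p * e₂) c₂ (u₂ * (n + l₂)) =
          (∑ n ∈ Finset.range p, eFrac p c₁ (e₁ * u₁ * (n + l₁)) * eFrac p c₂ (e₂ * u₂ * (n + l₂))) *
          ∑ n ∈ Finset.range E, eFrac e₁ c₁ (p * u₁ * (n + l₁)) * eFrac e₂ c₂ (p * u₂ * (n + l₂)) := by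
        rw [hDE, ← sum_range_mul_of_coprime_periodic hpE hp.ne_zero hE0
          (F := fun m : ℤ => eFrac p c₁ (e₁ * u₁ * (m + l₁)) * eFrac p c₂ (e₂ * u₂ * (m + l₂)))
          (G := fun m : ℤ => eFrac e₁ c₁ (p * u₁ * (m + l₁)) * eFrac e₂ c₂ (p * u₂ * (m + l₂)))]
        · refine Finset.sum_congr rfl fun n _ => ?_
          rw [hsplit₁, hsplit₂]; ring
        · intro m k
          rw [eFrac_arg_add_of_dvd (dvd_mul_right _ _), eFrac_arg_add_of_dvd (dvd_mul_right _ _)]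
        · intro m k
          rw [eFrac_arg_add_of_dvd (Dvd.dvd.mul_right (Int.natCast_dvd_natCast.mpr
              (Nat.dvd_lcm_left e₁ e₂)) k),
            eFrac_arg_add_of_dvd (Dvd.dvd.mul_right (Int.natCast_dvd_natCast.mpr
              (Nat.dvd_lcm_right e₁ e₂)) k)]
      rw [hsum, norm_mul]
      -- local factor: trivially `≤ p`
      have hloc : ‖∑ n ∈ Finset.range p, eFrac p c₁ (e₁ * u₁ * (n + l₁)) * eFrac p c₂ (e₂ * u₂ * (n + l₂))‖ ≤ p := by
        refine (norm_sum_le _ _).trans ?_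
        calc ∑ n ∈ Finset.range p, ‖eFrac p c₁ (e₁ * u₁ * (n + l₁)) * eFrac p c₂ (e₂ * u₂ * (n + l₂))‖
            ≤ ∑ n ∈ Finset.range p, (1 : ℝ) := Finset.sum_le_sum fun n _ => by
              rw [norm_mul]
              exact mul_le_one₀ (norm_eFrac_le_one _ _) (norm_nonneg _) (norm_eFrac_le_one _ _)
          _ = p := by simp
      -- cofactor: induction hypothesis
      have hrec := ih E hElt e₁ e₂ he₁ he₂ rfl c₁ c₂ l₁ l₂ (p * u₁) (p * u₂)
        (IsCoprime.mul_left hpZe hu₁e) (IsCoprime.mul_left ?_ hu₂e)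
      swap
      · exact Nat.isCoprime_iff_coprime.mpr hcop₂
      -- arithmetic of the bound
      have hδ₁ : p * e₁ / Nat.gcd (p * e₁) (p * e₂) = e₁ / Nat.gcd e₁ e₂ := by
        rw [hg]; exact Nat.mul_div_mul_left _ _ hp.pos
      have hδ₂ : p * e₂ / Nat.gcd (p * e₁) (p * e₂) = e₂ / Nat.gcd e₁ e₂ := by
        rw [hg]; exact Nat.mul_div_mul_left _ _ hp.pos
      rw [hδ₁, hδ₂, hg]
      have h0 : (0 : ℝ) ≤ Int.gcd c₁ (e₁ / Nat.gcd e₁ e₂ : ℕ) * Int.gcd c₂ (e₂ / Nat.gcd e₁ e₂ : ℕ) * Nat.gcd e₁ e₂ := by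
        positivity
      calc _ ≤ (p : ℝ) * (Int.gcd c₁ (e₁ / Nat.gcd e₁ e₂ : ℕ) * Int.gcd c₂ (e₂ / Nat.gcd e₁ e₂ : ℕ) * Nat.gcd e₁ e₂) :=
            mul_le_mul hloc hrec (norm_nonneg _) (Nat.cast_nonneg _)
        _ = _ := by push_cast; ring
    · -- Case `p ∣ d₁`, `p ∤ d₂`
      have hcop₂ : p.Coprime d₂ := (Nat.Prime.coprime_iff_not_dvd hp).mpr hpd₂
      set E : ℕ := Nat.lcm e₁ d₂ with hE
      have hE0 : E ≠ 0 := Nat.lcm_ne_zero he₁.ne_zero hd₂.ne_zero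
      have hDE : D = p * E := by rw [← hD, lcm_prime_mul_left hcop₂]
      have hElt : E < D := by
        rw [hDE]; exact lt_mul_left (Nat.pos_of_ne_zero hE0) hp.one_lt
      have hpE : p.Coprime E :=
        Nat.Coprime.coprime_dvd_right (Nat.lcm_dvd_mul e₁ d₂) (Nat.Coprime.mul_right hcop₁ hcop₂)
      have hg : Nat.gcd (p * e₁) d₂ = Nat.gcd e₁ d₂ := Nat.Coprime.gcd_mul_left_cancel e₁ hcop₂
      have hsum : ∑ n ∈ Finset.range D, eFrac (p * e₁) c₁ (u₁ * (n + l₁)) * eFrac d₂ c₂ (u₂ * (n + l₂)) =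
          (∑ n ∈ Finset.range p, eFrac p c₁ (e₁ * u₁ * (n + l₁))) *
          ∑ n ∈ Finset.range E, eFrac e₁ c₁ (p * u₁ * (n + l₁)) * eFrac d₂ c₂ (u₂ * (n + l₂)) := by
        rw [hDE, ← sum_range_mul_of_coprime_periodic hpE hp.ne_zero hE0
          (F := fun m : ℤ => eFrac p c₁ (e₁ * u₁ * (m + l₁)))
          (G := fun m : ℤ => eFrac e₁ c₁ (p * u₁ * (m + l₁)) * eFrac d₂ c₂ (u₂ * (m + l₂)))]
        · refine Finset.sum_congr rfl fun n _ => ?_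
          rw [hsplit₁]; ring
        · intro m k
          rw [eFrac_arg_add_of_dvd (dvd_mul_right _ _)]
        · intro m k
          rw [eFrac_arg_add_of_dvd (Dvd.dvd.mul_right (Int.natCast_dvd_natCast.mpr
              (Nat.dvd_lcm_left e₁ d₂)) k),
            eFrac_arg_add_of_dvd (Dvd.dvd.mul_right (Int.natCast_dvd_natCast.mpr
              (Nat.dvd_lcm_right e₁ d₂)) k)]
      rw [hsum, norm_mul]
      -- local factor: a Ramanujan sum
      have hloc : ‖∑ n ∈ Finset.range p, eFrac p c₁ (e₁ * u₁ * (n + l₁))‖ ≤ Int.gcd c₁ p :=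
        norm_sum_range_eFrac_unit_mul_add_le c₁ l₁ (IsCoprime.mul_left hpZe.symm hu₁p)
      -- cofactor: induction hypothesis
      have hrec := ih E hElt e₁ d₂ he₁ hd₂ rfl c₁ c₂ l₁ l₂ (p * u₁) u₂
        (IsCoprime.mul_left hpZe hu₁e) hu₂
      -- arithmetic of the bound
      have hgd : Nat.gcd e₁ d₂ ∣ e₁ := Nat.gcd_dvd_left e₁ d₂
      have hδ₁ : p * e₁ / Nat.gcd (p * e₁) d₂ = p * (e₁ / Nat.gcd e₁ d₂) := by
        rw [hg, Nat.mul_div_assoc p hgd]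
      have hcopδ : p.Coprime (e₁ / Nat.gcd e₁ d₂) :=
        Nat.Coprime.coprime_dvd_right (Nat.div_dvd_of_dvd hgd) hcop₁
      rw [hδ₁, hg, int_gcd_mul_of_coprime c₁ hcopδ]
      have h0 : (0 : ℝ) ≤ Int.gcd c₁ (e₁ / Nat.gcd e₁ d₂ : ℕ) * Int.gcd c₂ (d₂ / Nat.gcd e₁ d₂ : ℕ) * Nat.gcd e₁ d₂ := by
        positivity
      calc _ ≤ (Int.gcd c₁ p : ℝ) * (Int.gcd c₁ (e₁ / Nat.gcd e₁ d₂ : ℕ) * Int.gcd c₂ (d₂ / Nat.gcd e₁ d₂ : ℕ) * Nat.gcd e₁ d₂) :=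
            mul_le_mul hloc hrec (norm_nonneg _) (Nat.cast_nonneg _)
        _ = _ := by push_cast; ring
  -- the induction step proper
  intro d₁ d₂ _ _ hd₁ hd₂ hD c₁ c₂ l₁ l₂ u₁ u₂ hu₁ hu₂
  have hD0 : D ≠ 0 := by rw [← hD]; exact Nat.lcm_ne_zero hd₁.ne_zero hd₂.ne_zero
  by_cases hD1 : D = 1
  · -- base: `d₁ = d₂ = 1`
    have h1 : d₁ = 1 := Nat.dvd_one.mp (hD1 ▸ hD ▸ Nat.dvd_lcm_left d₁ d₂)
    have h2 : d₂ = 1 := Nat.dvd_one.mp (hD1 ▸ hD ▸ Nat.dvd_lcm_right d₁ d₂)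
    subst h1; subst h2; subst hD1
    simp [eFrac_one_left]
  · -- pick a prime `p ∣ D`; it divides `d₁` or `d₂`
    obtain ⟨p, hp, hpD'⟩ := Nat.exists_prime_and_dvd hD1
    have hpD : p ∣ d₁ * d₂ := hpD'.trans (hD ▸ Nat.lcm_dvd_mul d₁ d₂)
    rcases (Nat.Prime.dvd_mul hp).mp hpD with hpd₁ | hpd₂
    · exact key d₁ d₂ hd₁ hd₂ hD p hp hpd₁ c₁ c₂ l₁ l₂ u₁ u₂ hu₁ hu₂
    · -- symmetry `1 ↔ 2`
      have h := key d₂ d₁ hd₂ hd₁ (by rw [Nat.lcm_comm, hD]) p hp hpd₂ c₂ c₁ l₂ l₁ u₂ u₁ hu₂ hu₁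
      rw [Nat.gcd_comm d₂ d₁] at h
      have hcomm : ∑ n ∈ Finset.range D, eFrac d₁ c₁ (u₁ * (n + l₁)) * eFrac d₂ c₂ (u₂ * (n + l₂)) =
          ∑ n ∈ Finset.range D, eFrac d₂ c₂ (u₂ * (n + l₂)) * eFrac d₁ c₁ (u₁ * (n + l₁)) :=
        Finset.sum_congr rfl fun n _ => mul_comm _ _
      rw [hcomm]
      refine h.trans (le_of_eq ?_)
      ring

/-- **Polymath 8a, Lemma 4.8** (with the constant `C = 1`): "Let `d₁, d₂` be squarefree integers, so
that `[d₁,d₂]` is squarefree, and let `c₁, c₂, l₁, l₂` be integers. Then …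
`|∑_{n ∈ ℤ/[d₁,d₂]ℤ} e_{d₁}(c₁/(n+l₁)) e_{d₂}(c₂/(n+l₂))| ≤ C^{Ω([d₁,d₂])} (c₁,δ₁)(c₂,δ₂)(d₁,d₂)` where
`δ_i := d_i/(d₁,d₂)`" — here `|…| ≤ (c₁,δ₁)(c₂,δ₂)(d₁,d₂)`.  Proof as printed, prime by prime
(Lemma 4.4): at a prime dividing exactly one `d_i` the local sum is a Ramanujan sum, bounded by
`(c_i, p)`; at a prime dividing both, the trivial bound `p` is used.
[cite: Polymath8a2014, Lemma 4.8] -/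
theorem norm_sum_eFrac_mul_eFrac_le {d₁ d₂ : ℕ} [NeZero d₁] [NeZero d₂] (hd₁ : Squarefree d₁)
    (hd₂ : Squarefree d₂) (c₁ c₂ l₁ l₂ : ℤ) :
    ‖∑ n ∈ Finset.range (Nat.lcm d₁ d₂), eFrac d₁ c₁ (n + l₁) * eFrac d₂ c₂ (n + l₂)‖ ≤
      Int.gcd c₁ (d₁ / Nat.gcd d₁ d₂ : ℕ) * Int.gcd c₂ (d₂ / Nat.gcd d₁ d₂ : ℕ) * Nat.gcd d₁ d₂ := by
  have h := norm_sum_eFrac_mul_eFrac_le_aux (Nat.lcm d₁ d₂) d₁ d₂ hd₁ hd₂ rfl c₁ c₂ l₁ l₂ 1 1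
    isCoprime_one_left isCoprime_one_left
  simpa only [one_mul] using h

end Polymath8a

end Literature.NumberTheory.Sieve
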